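import Mathlib
import Summits.KontsevichZagierPeriods.KontsevichZagierPeriods.Theorems.SoloInformedDivisionNeg
import HarnessLib
import HarnessLib.Audit

/-!
# Division by translation XIII: the bisection chain — THEOREM XXIX at order 2 for EVERY modulus (solo-informed, s44)

Parts III–X prove THEOREM XXIX (i) hyperbolic, (ii) circular, (iii) negative at every torsion order `q`
GIVEN a division chain `SoloInformedDivChain m q`; part VIII supplies a chain at order `3` along the
one-parameter trisection family.  Here the hypothesis is discharged at order `2` for EVERY real algebraic
modulus `0 < m < 1`: with `k' = √(1−m)` the half-period abscissa is

  `a = sn(K/2 | m) = 1/√(1 + k')`,  `1 − a² = k'a²`,  `1 − m a² = k'`,  `c_a d_a = k'a`,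

so Jacobi's addition map closes the chain, `T_a(a) = 2a·c_a d_a/(1 − m a⁴) = 2k'a²/(2k'a²) = 1`, with the
no-fold condition an equality: `(0, a, 1)` is a `SoloInformedDivChain m 2` (`soloInformedDivChainTwo`,
NON-VACUITY of parts III–X at every modulus).  The general machine then returns, uniformly (`ζ₁ = 0`,
`ζ₂ = m a² = 1 − k'`, Kummer scalar `c_σ = k'`, circular scalar `c = 1 − k'`):

* (i)   `⟦Π(1 − k' | m)⟧ = ⟦[pt, (1+k')/(2k')]⟧·⟦K(m)⟧`  — COROLLARY XXVIII.4 (`soloInformed_ellipticPi_fixedPole`,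
        there by ONE involution move) re-derived by two translation moves (`soloInformed_bisection_thirdKind`);
* (ii)  `Π(k' | k'²) = ½·K(k'²) + π/(4(1−k'))`  — THEOREM XXIV's torsion value (`soloInformed_bisection_circular_value`);
* (iii) `Π(−k' | k'²) = ½·K(k'²) + π/(4(1+k'))` — COROLLARY XXIX.5 (`soloInformed_bisection_negative_value`);

fibres `m = ¾`: `2·Π(½ | ¾) = 3·K(¾)`, `2·Π(½ | ¼) = K(¼) + π`.  Three independent kernel proofs of the
order-two packet now agree (involution XXVIII(c), quarter turn XXXI′, division XXIX), which certifies the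
normalisations `λ = 1 + (pζ_q − qζ_p)/(q c_σ)`, `A`, `B`, `a′`, `b′` of parts VII, IX, X at `(p, q) = (1, 2)`.
References: C. G. J. Jacobi, *Fundamenta nova* (1829), §§20, 55; Abramowitz–Stegun 17.7.x;
M. Kontsevich, D. Zagier, *Periods* (2001), §1.2; this work.
-/

noncomputable section

open MeasureTheory Set Filter
open scoped Classical

open Literature.NumberTheory.Transcendental Literature.NumberTheory.Transcendental.KZ
open Literature.ModelTheory.ExponentialFields

namespace Summit.KontsevichZagierPeriods.KontsevichZagierPeriods.Theorems

/-! ### The half-period abscissa `sn(K/2) = 1/√(1+k')` -/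

/-- `sn(K/2 | m) = 1/√(1 + √(1−m))`. [Jacobi 1829, §20] -/
def soloInformedSnHalf (m : ℝ) : ℝ := (√(1 + √(1 - m)))⁻¹

/-- Basic facts: `0 < k' < 1`, `k'² = 1 − m`, `0 < a`, `a²(1+k') = 1`. [folklore] -/
theorem soloInformed_snHalf_facts {m : ℝ} (hm : m ∈ Ioo (0:ℝ) 1) :
    0 < √(1 - m) ∧ √(1 - m) < 1 ∧ √(1 - m) ^ 2 = 1 - m ∧ 0 < soloInformedSnHalf m ∧
      soloInformedSnHalf m ^ 2 * (1 + √(1 - m)) = 1 := by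
  have h1m : 0 < 1 - m := by linarith [hm.2]
  have hk0 : 0 < √(1 - m) := Real.sqrt_pos.2 h1m
  have hk1 : √(1 - m) < 1 := (Real.sqrt_lt' one_pos).2 (by nlinarith [hm.1])
  have hS : 0 < 1 + √(1 - m) := by linarith
  have ha2 : soloInformedSnHalf m ^ 2 = (1 + √(1 - m))⁻¹ := by
    rw [soloInformedSnHalf, inv_pow, Real.sq_sqrt hS.le]
  refine ⟨hk0, hk1, Real.sq_sqrt h1m.le, inv_pos.2 (Real.sqrt_pos.2 hS), ?_⟩
  rw [ha2, inv_mul_cancel₀ hS.ne']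

/-- `1 − a² = k'a²`, `1 − m a² = k'`, `m a² = 1 − k'`. [Jacobi 1829, §20] -/
theorem soloInformed_snHalf_sq {m : ℝ} (hm : m ∈ Ioo (0:ℝ) 1) :
    1 - soloInformedSnHalf m ^ 2 = √(1 - m) * soloInformedSnHalf m ^ 2 ∧
    1 - m * soloInformedSnHalf m ^ 2 = √(1 - m) ∧
    m * soloInformedSnHalf m ^ 2 = 1 - √(1 - m) := by
  obtain ⟨-, -, hk2, -, haS⟩ := soloInformed_snHalf_facts hm
  refine ⟨by linear_combination -haS, ?_, ?_⟩
  · linear_combination (-(1 - √(1 - m))) * haS - soloInformedSnHalf m ^ 2 * hk2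
  · linear_combination (1 - √(1 - m)) * haS + soloInformedSnHalf m ^ 2 * hk2

/-- Square roots: `c_a = √k'·a`, `d_a = √k'`, `c_a d_a = k' a`, `√((1−a²)(1−m a²)) = k' a`.
[Jacobi 1829, §20] -/
theorem soloInformed_snHalf_sqrt {m : ℝ} (hm : m ∈ Ioo (0:ℝ) 1) :
    √(1 - soloInformedSnHalf m ^ 2) = √(√(1 - m)) * soloInformedSnHalf m ∧
    √(1 - m * soloInformedSnHalf m ^ 2) = √(√(1 - m)) ∧
    √(1 - soloInformedSnHalf m ^ 2) * √(1 - m * soloInformedSnHalf m ^ 2) =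
      √(1 - m) * soloInformedSnHalf m ∧
    √((1 - soloInformedSnHalf m ^ 2) * (1 - m * soloInformedSnHalf m ^ 2)) =
      √(1 - m) * soloInformedSnHalf m := by
  obtain ⟨hk0, -, -, ha0, -⟩ := soloInformed_snHalf_facts hm
  obtain ⟨f1, f2, -⟩ := soloInformed_snHalf_sq hm
  have e1 : √(1 - soloInformedSnHalf m ^ 2) = √(√(1 - m)) * soloInformedSnHalf m := by
    rw [f1, Real.sqrt_mul' _ (sq_nonneg _), Real.sqrt_sq ha0.le]
  have e2 : √(1 - m * soloInformedSnHalf m ^ 2) = √(√(1 - m)) := by rw [f2]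
  have e3 : √(1 - soloInformedSnHalf m ^ 2) * √(1 - m * soloInformedSnHalf m ^ 2) =
      √(1 - m) * soloInformedSnHalf m := by
    rw [e1, e2]
    have hrr := Real.mul_self_sqrt hk0.le
    linear_combination soloInformedSnHalf m * hrr
  have hn1 : 0 ≤ 1 - soloInformedSnHalf m ^ 2 := by
    rw [f1]; exact mul_nonneg hk0.le (sq_nonneg _)
  exact ⟨e1, e2, e3, by rw [Real.sqrt_mul hn1, e3]⟩

/-- `a` is algebraic for algebraic `m`. [folklore] -/
theorem soloInformed_snHalf_isAlgebraic {m : ℝ} (hm : m ∈ Ioo (0:ℝ) 1) (hma : IsAlgebraic ℚ m) :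
    IsAlgebraic ℚ (√(1 - m)) ∧ IsAlgebraic ℚ (soloInformedSnHalf m) := by
  obtain ⟨hk0, -, hk2, -, -⟩ := soloInformed_snHalf_facts hm
  have hk : IsAlgebraic ℚ (√(1 - m)) :=
    IsAlgebraic.of_pow two_pos (by rw [hk2]; exact isAlgebraic_one.sub hma)
  have hS : (0:ℝ) ≤ 1 + √(1 - m) := by linarith
  have hr : IsAlgebraic ℚ (√(1 + √(1 - m))) :=
    IsAlgebraic.of_pow two_pos (by rw [Real.sq_sqrt hS]; exact isAlgebraic_one.add hk)
  exact ⟨hk, hr.inv⟩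

/-- Jacobi's addition map closes the bisection chain: `T_a(a) = 1`. [Jacobi 1829, §20] -/
theorem soloInformed_snHalf_step {m : ℝ} (hm : m ∈ Ioo (0:ℝ) 1) :
    soloInformedAddm m (soloInformedSnHalf m) (soloInformedSnHalf m) = 1 := by
  obtain ⟨hk0, -, -, ha0, haS⟩ := soloInformed_snHalf_facts hm
  obtain ⟨-, -, f3⟩ := soloInformed_snHalf_sq hm
  obtain ⟨-, -, e3, -⟩ := soloInformed_snHalf_sqrt hm
  have hD : 1 - m * soloInformedSnHalf m ^ 2 * soloInformedSnHalf m ^ 2 =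
      2 * √(1 - m) * soloInformedSnHalf m ^ 2 := by
    linear_combination (-(soloInformedSnHalf m ^ 2)) * f3 - haS
  have hD0 : 1 - m * soloInformedSnHalf m ^ 2 * soloInformedSnHalf m ^ 2 ≠ 0 := by
    rw [hD]; positivity
  unfold soloInformedAddm
  rw [e3, div_eq_one_iff_eq hD0, hD]
  ring

/-! ### The bisection chain `(0, a, 1)` -/

/-- Abscissae of the bisection chain: `0, a, 1, 1, …`. [this work] -/
def soloInformedS2 (m : ℝ) : ℕ → ℝ := fun j =>
  if j = 0 then 0 else if j = 1 then soloInformedSnHalf m else 1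

/-- `s₀ = 0`. -/
theorem soloInformed_s2_zero {m : ℝ} : soloInformedS2 m 0 = 0 := by simp [soloInformedS2]
/-- `s₁ = a`. -/
theorem soloInformed_s2_one {m : ℝ} : soloInformedS2 m 1 = soloInformedSnHalf m := by
  simp [soloInformedS2]
/-- `s₂ = 1`. -/
theorem soloInformed_s2_two {m : ℝ} : soloInformedS2 m 2 = 1 := by simp [soloInformedS2]

/-- **The bisection chain** `(0, sn(K/2), 1)`: a division chain of order `2` for EVERY real algebraic
modulus `0 < m < 1` — non-vacuity of THEOREM XXIX KERNEL (parts VII, IX, X) at every modulus.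
[this work] -/
def soloInformedDivChainTwo (m : ℝ) (hm : m ∈ Ioo (0:ℝ) 1) (hma : IsAlgebraic ℚ m) :
    SoloInformedDivChain m 2 where
  s := soloInformedS2 m
  s_zero := soloInformed_s2_zero
  one_pos := by rw [soloInformed_s2_one]; exact (soloInformed_snHalf_facts hm).2.2.2.1
  one_le := by
    obtain ⟨hk0, -, -, ha0, haS⟩ := soloInformed_snHalf_facts hm
    rw [soloInformed_s2_one]
    nlinarith [haS, ha0, hk0, sq_nonneg (soloInformedSnHalf m)]
  one_isAlgebraic := by
    rw [soloInformed_s2_one]; exact (soloInformed_snHalf_isAlgebraic hm hma).2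
  step := by
    intro j hj
    interval_cases j
    · show soloInformedS2 m 1 = _
      rw [soloInformed_s2_one, soloInformed_s2_zero, soloInformed_addm_origin]
    · show soloInformedS2 m 2 = _
      rw [soloInformed_s2_two, soloInformed_s2_one, soloInformed_snHalf_step hm]
  turn := by
    obtain ⟨-, f2, -⟩ := soloInformed_snHalf_sq hm
    obtain ⟨f1, -, -⟩ := soloInformed_snHalf_sq hm
    intro j hj
    interval_cases j
    · rw [soloInformed_s2_one, soloInformed_s2_zero]
      obtain ⟨hk0, -, -, ha0, haS⟩ := soloInformed_snHalf_facts hm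
      nlinarith [haS, hk0, sq_nonneg (soloInformedSnHalf m)]
    · rw [soloInformed_s2_one, f2, f1]
      exact le_of_eq (mul_comm _ _)
  top := soloInformed_s2_two

/-- The underlying sequence of the bisection chain. -/
theorem soloInformed_divChainTwo_s {m : ℝ} (hm : m ∈ Ioo (0:ℝ) 1) (hma : IsAlgebraic ℚ m) :
    (soloInformedDivChainTwo m hm hma).s = soloInformedS2 m := rfl

/-- `ζ₂ = m a²` (`= 1 − k'`; model `2E(K/2) − E = 1 − k'`) along the bisection chain. [Jacobi 1829, §55] -/
theorem soloInformed_divChainTwo_zeta {m : ℝ} (hm : m ∈ Ioo (0:ℝ) 1) (hma : IsAlgebraic ℚ m) :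
    (soloInformedDivChainTwo m hm hma).zeta 2 = m * soloInformedSnHalf m ^ 2 := by
  rw [SoloInformedDivChain.zeta, Finset.sum_range_succ, Finset.sum_range_succ,
    Finset.sum_range_zero, soloInformed_divChainTwo_s]
  simp only [soloInformed_s2_zero, soloInformed_s2_one, soloInformed_s2_two, Nat.reduceAdd]
  ring

/-! ### (i) The hyperbolic packet: COROLLARY XXVIII.4 by division -/

/-- **THEOREM XXIX(i) at order 2, every modulus.** For every real algebraic `0 < m < 1`, `k' = √(1−m)`,
and all representations `Π = [(0,1), κ_m/(1−(1−k')x²)]`, `K = [(0,1), κ_m]`: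
`⟦Π(1−k' | m)⟧ = ⟦[pt, (1+k')/(2k')]⟧·⟦K(m)⟧` in `P` — COROLLARY XXVIII.4 by two translation moves.
[this work] -/
theorem soloInformed_bisection_thirdKind (m : ℝ) (hm : m ∈ Ioo (0:ℝ) 1) (hma : IsAlgebraic ℚ m)
    (PN K : IntegralRep 1) (hPNd : PN.domain = {x | x 0 ∈ Ioo (0:ℝ) 1})
    (hPNi : EqOn PN.integrand (fun x => (1 - (1 - √(1 - m)) * x 0 ^ 2)⁻¹ *
      ((√(1 - x 0 ^ 2))⁻¹ * (√(1 - m * x 0 ^ 2))⁻¹)) PN.domain)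
    (hKd : K.domain = {x | x 0 ∈ Ioo (0:ℝ) 1})
    (hKi : EqOn K.integrand (fun x => (√(1 - x 0 ^ 2))⁻¹ * (√(1 - m * x 0 ^ 2))⁻¹) K.domain) :
    IsAlgebraic ℚ ((1 + √(1 - m)) / (2 * √(1 - m))) ∧
      ∀ hl : IsAlgebraic ℚ ((1 + √(1 - m)) / (2 * √(1 - m))),
      toFormalPeriod (of PN) =
        toFormalPeriod (of (IntegralRep.unit.constMul _ hl)) * toFormalPeriod (of K) := by
  obtain ⟨hk0, -, -, ha0, -⟩ := soloInformed_snHalf_facts hm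
  obtain ⟨-, -, hn⟩ := soloInformed_snHalf_sq hm
  obtain ⟨-, -, -, e4⟩ := soloInformed_snHalf_sqrt hm
  obtain ⟨hka, -⟩ := soloInformed_snHalf_isAlgebraic hm hma
  have h2a : IsAlgebraic ℚ (2:ℝ) := by simpa using isAlgebraic_nat (R := ℚ) (A := ℝ) 2
  have hl : IsAlgebraic ℚ ((1 + √(1 - m)) / (2 * √(1 - m))) := by
    rw [div_eq_mul_inv]; exact (isAlgebraic_one.add hka).mul (h2a.mul hka).inv
  have hS1 : (soloInformedDivChainTwo m hm hma).s 1 = soloInformedSnHalf m := soloInformed_s2_one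
  have hPNi' : EqOn PN.integrand (fun x => (1 - m *
      (soloInformedDivChainTwo m hm hma).s 1 ^ 2 * x 0 ^ 2)⁻¹ *
      ((√(1 - x 0 ^ 2))⁻¹ * (√(1 - m * x 0 ^ 2))⁻¹)) PN.domain := by
    intro x hx
    rw [hPNi hx, hS1, hn]
  refine ⟨hl, fun hl' => ?_⟩
  obtain ⟨hl0, h⟩ := soloInformed_divChain_thirdKind_pointClass (soloInformedDivChainTwo m hm hma)
    hm hma (p := 1) one_pos (by norm_num) PN K hPNd hPNi' hKd hKi
  rw [h hl0, soloInformed_pointRep_congr hl0 hl' ?_]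
  rw [hS1, soloInformed_divChainTwo_zeta hm hma, SoloInformedDivChain.zeta_one, e4, hn]
  have ha0' : soloInformedSnHalf m ≠ 0 := ha0.ne'
  have hk0' : √(1 - m) ≠ 0 := hk0.ne'
  rw [mul_div_cancel_right₀ _ ha0']
  push_cast
  field_simp
  ring

/-- **THEOREM XXIX(i) at order 2, numerically:** `Π(1−√(1−m) | m) = (1+√(1−m))/(2√(1−m))·K(m)`.
[this work] -/
theorem soloInformed_bisection_thirdKind_value (m : ℝ) (hm : m ∈ Ioo (0:ℝ) 1)
    (hma : IsAlgebraic ℚ m)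
    (PN K : IntegralRep 1) (hPNd : PN.domain = {x | x 0 ∈ Ioo (0:ℝ) 1})
    (hPNi : EqOn PN.integrand (fun x => (1 - (1 - √(1 - m)) * x 0 ^ 2)⁻¹ *
      ((√(1 - x 0 ^ 2))⁻¹ * (√(1 - m * x 0 ^ 2))⁻¹)) PN.domain)
    (hKd : K.domain = {x | x 0 ∈ Ioo (0:ℝ) 1})
    (hKi : EqOn K.integrand (fun x => (√(1 - x 0 ^ 2))⁻¹ * (√(1 - m * x 0 ^ 2))⁻¹) K.domain) :
    PN.value = (1 + √(1 - m)) / (2 * √(1 - m)) * K.value := by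
  obtain ⟨hl, h⟩ := soloInformed_bisection_thirdKind m hm hma PN K hPNd hPNi hKd hKi
  have e := congrArg evalP (h hl)
  simpa only [map_mul, evalP_toFormalPeriod_of, IntegralRep.value_constMul,
    IntegralRep.value_unit, mul_one] using e

/-- The fibre `m = ¾` (`k' = ½`, `n = ½`): **`2·Π(½ | ¾) = 3·K(¾)`** for all representations.
[this work] -/
theorem soloInformed_bisection_fibre (PN K : IntegralRep 1)
    (hPNd : PN.domain = {x | x 0 ∈ Ioo (0:ℝ) 1})
    (hPNi : EqOn PN.integrand (fun x => (1 - 1 / 2 * x 0 ^ 2)⁻¹ *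
      ((√(1 - x 0 ^ 2))⁻¹ * (√(1 - 3 / 4 * x 0 ^ 2))⁻¹)) PN.domain)
    (hKd : K.domain = {x | x 0 ∈ Ioo (0:ℝ) 1})
    (hKi : EqOn K.integrand (fun x => (√(1 - x 0 ^ 2))⁻¹ * (√(1 - 3 / 4 * x 0 ^ 2))⁻¹)
      K.domain) :
    2 * PN.value = 3 * K.value := by
  have hm : (3/4 : ℝ) ∈ Ioo (0:ℝ) 1 := by norm_num
  have hma : IsAlgebraic ℚ (3/4 : ℝ) := by
    simpa using isAlgebraic_algebraMap (R := ℚ) (A := ℝ) (3/4 : ℚ)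
  have hk : √(1 - (3/4 : ℝ)) = 1 / 2 := by
    rw [show (1:ℝ) - 3/4 = (1/2) ^ 2 by norm_num, Real.sqrt_sq (by norm_num)]
  have hn : (1:ℝ) - √(1 - 3/4) = 1 / 2 := by rw [hk]; norm_num
  have hv := soloInformed_bisection_thirdKind_value (3/4) hm hma PN K hPNd
    (by rw [hn]; exact hPNi) hKd hKi
  rw [hv, hk]
  ring

/-! ### (ii) The circular packet: THEOREM XXIV's value by division -/

/-- The circular scalar of the bisection chain: `c = m a·c_a/d_a = m a² = 1 − k'`. [this work] -/
theorem soloInformed_bisection_circScalar {m : ℝ} (hm : m ∈ Ioo (0:ℝ) 1) :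
    m * soloInformedSnHalf m * √(1 - soloInformedSnHalf m ^ 2) /
      √(1 - m * soloInformedSnHalf m ^ 2) = 1 - √(1 - m) := by
  obtain ⟨hk0, -, -, ha0, -⟩ := soloInformed_snHalf_facts hm
  obtain ⟨-, -, hn⟩ := soloInformed_snHalf_sq hm
  obtain ⟨e1, e2, -, -⟩ := soloInformed_snHalf_sqrt hm
  have hr : √(√(1 - m)) ≠ 0 := (Real.sqrt_pos.2 hk0).ne'
  rw [e1, e2, ← hn, div_eq_iff hr]
  ring

/-- **THEOREM XXIX(ii) at order 2, numerically, every modulus:** for real algebraic `0 < m < 1`,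
`k' = √(1−m)`, and all representations of modulus `1 − m = k'²`:
`Π(k' | k'²) = ½·K(k'²) + π/(4(1−k'))` — THEOREM XXIV's torsion value, by division. [this work] -/
theorem soloInformed_bisection_circular_value (m : ℝ) (hm : m ∈ Ioo (0:ℝ) 1)
    (hma : IsAlgebraic ℚ m)
    (PN K : IntegralRep 1) (hPNd : PN.domain = {x | x 0 ∈ Ioo (0:ℝ) 1})
    (hPNi : EqOn PN.integrand (fun x => (1 - √(1 - m) * x 0 ^ 2)⁻¹ *
      ((√(1 - x 0 ^ 2))⁻¹ * (√(1 - (1 - m) * x 0 ^ 2))⁻¹)) PN.domain)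
    (hKd : K.domain = {x | x 0 ∈ Ioo (0:ℝ) 1})
    (hKi : EqOn K.integrand (fun x => (√(1 - x 0 ^ 2))⁻¹ * (√(1 - (1 - m) * x 0 ^ 2))⁻¹)
      K.domain) :
    PN.value = 1 / 2 * K.value + 1 / (4 * (1 - √(1 - m))) * Real.pi := by
  obtain ⟨hk0, hk1, -, ha0, -⟩ := soloInformed_snHalf_facts hm
  obtain ⟨-, f2, hn⟩ := soloInformed_snHalf_sq hm
  have hS1 : (soloInformedDivChainTwo m hm hma).s 1 = soloInformedSnHalf m := soloInformed_s2_one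
  have hPNi' : EqOn PN.integrand (fun x => (1 - (1 - m *
      (soloInformedDivChainTwo m hm hma).s 1 ^ 2) * x 0 ^ 2)⁻¹ *
      ((√(1 - x 0 ^ 2))⁻¹ * (√(1 - (1 - m) * x 0 ^ 2))⁻¹)) PN.domain := by
    intro x hx
    rw [hPNi hx, hS1, f2]
  have hv := soloInformed_divChain_circular_value (soloInformedDivChainTwo m hm hma) hm hma
    (p := 1) one_pos (by norm_num) PN K hPNd hPNi' hKd hKi
  rw [hS1, soloInformed_divChainTwo_zeta hm hma, SoloInformedDivChain.zeta_one,
    soloInformed_bisection_circScalar hm, hn] at hv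
  push_cast at hv
  have h1k : 1 - √(1 - m) ≠ 0 := (by linarith : (0:ℝ) < 1 - √(1 - m)).ne'
  rw [hv]
  field_simp
  ring

/-- The fibre `m = ¾` (`k' = ½`): **`2·Π(½ | ¼) = K(¼) + π`** for all representations. [this work] -/
theorem soloInformed_bisection_circular_fibre (PN K : IntegralRep 1)
    (hPNd : PN.domain = {x | x 0 ∈ Ioo (0:ℝ) 1})
    (hPNi : EqOn PN.integrand (fun x => (1 - 1 / 2 * x 0 ^ 2)⁻¹ *
      ((√(1 - x 0 ^ 2))⁻¹ * (√(1 - 1 / 4 * x 0 ^ 2))⁻¹)) PN.domain)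
    (hKd : K.domain = {x | x 0 ∈ Ioo (0:ℝ) 1})
    (hKi : EqOn K.integrand (fun x => (√(1 - x 0 ^ 2))⁻¹ * (√(1 - 1 / 4 * x 0 ^ 2))⁻¹)
      K.domain) :
    2 * PN.value = K.value + Real.pi := by
  have hm : (3/4 : ℝ) ∈ Ioo (0:ℝ) 1 := by norm_num
  have hma : IsAlgebraic ℚ (3/4 : ℝ) := by
    simpa using isAlgebraic_algebraMap (R := ℚ) (A := ℝ) (3/4 : ℚ)
  have hk : √(1 - (3/4 : ℝ)) = 1 / 2 := by
    rw [show (1:ℝ) - 3/4 = (1/2) ^ 2 by norm_num, Real.sqrt_sq (by norm_num)]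
  have hq : (1:ℝ) - 3/4 = 1 / 4 := by norm_num
  have hv := soloInformed_bisection_circular_value (3/4) hm hma PN K hPNd
    (by rw [hk, hq]; exact hPNi) hKd (by rw [hq]; exact hKi)
  rw [hv, hk]
  ring

/-! ### (iii) The negative packet: COROLLARY XXIX.5 by division -/

/-- **THEOREM XXIX(iii) at order 2, numerically, every modulus:** for real algebraic `0 < m < 1`,
`k' = √(1−m)`, and all representations of modulus `k'²`:
`Π(−k' | k'²) = ½·K(k'²) + π/(4(1+k'))` — COROLLARY XXIX.5, by division. [this work] -/
theorem soloInformed_bisection_negative_value (m : ℝ) (hm : m ∈ Ioo (0:ℝ) 1)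
    (hma : IsAlgebraic ℚ m)
    (PN K : IntegralRep 1) (hPNd : PN.domain = {x | x 0 ∈ Ioo (0:ℝ) 1})
    (hPNi : EqOn PN.integrand (fun x => (1 + √(1 - m) * x 0 ^ 2)⁻¹ *
      ((√(1 - x 0 ^ 2))⁻¹ * (√(1 - (1 - m) * x 0 ^ 2))⁻¹)) PN.domain)
    (hKd : K.domain = {x | x 0 ∈ Ioo (0:ℝ) 1})
    (hKi : EqOn K.integrand (fun x => (√(1 - x 0 ^ 2))⁻¹ * (√(1 - (1 - m) * x 0 ^ 2))⁻¹)
      K.domain) :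
    PN.value = 1 / 2 * K.value + 1 / (4 * (1 + √(1 - m))) * Real.pi := by
  obtain ⟨hk0, hk1, hk2, ha0, haS⟩ := soloInformed_snHalf_facts hm
  obtain ⟨f1, f2, hn⟩ := soloInformed_snHalf_sq hm
  have hS1 : (soloInformedDivChainTwo m hm hma).s 1 = soloInformedSnHalf m := soloInformed_s2_one
  have hq : (1 - soloInformedSnHalf m ^ 2) / soloInformedSnHalf m ^ 2 = √(1 - m) := by
    rw [f1, mul_div_assoc, div_self (pow_ne_zero 2 ha0.ne'), mul_one]
  have hPNi' : EqOn PN.integrand (fun x => (1 + (1 - (soloInformedDivChainTwo m hm hma).s 1 ^ 2) /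
      (soloInformedDivChainTwo m hm hma).s 1 ^ 2 * x 0 ^ 2)⁻¹ *
      ((√(1 - x 0 ^ 2))⁻¹ * (√(1 - (1 - m) * x 0 ^ 2))⁻¹)) PN.domain := by
    intro x hx
    rw [hPNi hx, hS1, hq]
  have hv := soloInformed_divChain_negative_value (soloInformedDivChainTwo m hm hma) hm hma
    (p := 1) one_pos (by norm_num) PN K hPNd hPNi' hKd hKi
  rw [hS1, soloInformed_divChainTwo_zeta hm hma, SoloInformedDivChain.zeta_one,
    soloInformed_bisection_circScalar hm, f2, f1, hn] at hv
  push_cast at hv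
  have h1k : 1 - √(1 - m) ≠ 0 := (by linarith : (0:ℝ) < 1 - √(1 - m)).ne'
  have h1k' : 1 + √(1 - m) ≠ 0 := (by linarith : (0:ℝ) < 1 + √(1 - m)).ne'
  have hk0' : √(1 - m) ≠ 0 := hk0.ne'
  set k := √(1 - m) with hk
  have ha2 : soloInformedSnHalf m ^ 2 = (1 + k)⁻¹ := by
    rw [inv_eq_one_div, eq_div_iff h1k']; exact haS
  have hmk : m = 1 - k ^ 2 := by linarith
  rw [hv, ha2, hmk]
  field_simp
  ring

end Summit.KontsevichZagierPeriods.KontsevichZagierPeriods.Theorems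

end
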